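import Literature.RingTheory.CohomologyAnnihilator.BaseChangeRetract
import Literature.RingTheory.CohomologyAnnihilator.StrongGenerator
import Literature.RingTheory.CohomologyAnnihilator.RegularRing
import Literature.RingTheory.CohomologyAnnihilator.StableAnnihilation
import HarnessLib

/-!
# A depth floor for the cohomology annihilator from a split finite-dimensional cover

Helper for the crux `NoZenoR` (stmt-ResolutionOfSingularities-19943), W4.4 toric arenas
(lead g13, KERNEL-g13 §3.1): if an `A`-algebra `B` splits off `A` as an `A`-module
(`ρ : B →ₗ[A] A`, `ρ 1 = 1`) and every finitely generated `B`-module has projective dimension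
`≤ d` (stated as `ca^{d+1}(B) = B`, e.g. `B` regular of Krull dimension `≤ d`), then the ideal
`I = ann_A Ext^{≥1}_A(B|_A, mod A)` of elements of `A` killing all positive `Ext` out of `B`
viewed as an `A`-module satisfies `I^{d+1} ⊆ ca^{d+1}(A) ⊆ ca(A)`.

For a simplicial toric threefold `A = k[σ^∨ ∩ M] ⊂ B = k[y₁, y₂, y₃]` (an abelian quotient
`𝔸³/G`, the splitting being the projection onto the invariant degree) the ideal `I` contains the
trace conductor `TR = ⋂_χ tr(S_χ)`, whence the floor `TR⁴ ⊆ ca(A)` used in the depth sieve of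
KERNEL-g13 §3. Mechanism: `M` is a retract of `(B ⊗_A M)|_A`
(`exists_retract_restrictScalars_baseChange`); `B ⊗_A M` has a finite `B`-projective
resolution of length `≤ d`; restricted to `A` its terms lie in `add(B|_A)` and are killed by
`I` in positive degrees; dimension shifting in the COKERNEL direction costs one factor of `I`
per step. The pattern is the descent step in the proof of [IyengarTakahashi2014, Thm. 5.4]; the
statement in this form is this work (candidate helper; not a statement of any manuscript).

## References

* S. B. Iyengar, R. Takahashi, *Annihilation of cohomology and strong generation of module
  categories*, IMRN 2016; arXiv:1404.1476 — Remark 2.3, Lemma 4.2, proof of Theorem 5.4.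
  [`IyengarTakahashi2014`]
-/

noncomputable section

open CategoryTheory CategoryTheory.Abelian CategoryTheory.Limits
open Literature.RingTheory.CohomologyAnnihilator

universe u

-- single-problem summit: the doubled namespace component `ResolutionOfSingularities` is forced by the layout
set_option linter.dupNamespace false

namespace Summit.ResolutionOfSingularities.ResolutionOfSingularities.Theorems.NoZeno.SplitCoverFloor

variable {A : Type u} [CommRing A]

/-- **Dimension shifting for annihilators, cokernel direction.** Let `0 → X₁ → X₂ → X₃ → 0` be
short exact in `ModuleCat A`. If `c` kills `Extⁱ(X₁, N)` and `d` kills `Extⁱ⁺¹(X₂, N)` then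
`c * d` kills `Extⁱ⁺¹(X₃, N)`: in the exact `Extⁱ(X₁, N) —δ→ Extⁱ⁺¹(X₃, N) → Extⁱ⁺¹(X₂, N)` the
class `d • e` restricts to zero on `X₂`, so it is `δ η`, and `c • δ η = δ (c • η) = 0`.
[cite: IyengarTakahashi2014, Remark 2.3] -/
theorem mul_smul_ext_eq_zero_of_shortExact_X₃ {S : ShortComplex (ModuleCat.{u} A)}
    (hS : S.ShortExact) {N : ModuleCat.{u} A} {i : ℕ} {c d : A}
    (hc : ∀ e : Ext.{u} S.X₁ N i, c • e = 0) (hd : ∀ e : Ext.{u} S.X₂ N (i + 1), d • e = 0)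
    (e : Ext.{u} S.X₃ N (i + 1)) : (c * d) • e = 0 := by
  have h0 : (Ext.mk₀ S.g).comp (d • e) (zero_add (i + 1)) = 0 := by
    rw [Ext.comp_smul, hd]
  obtain ⟨x₁, hx₁⟩ := Ext.contravariant_sequence_exact₃ hS N (d • e) h0 (add_comm 1 i)
  rw [mul_smul, ← hx₁, ← Ext.comp_smul, hc, Ext.comp_zero]

variable {B : Type u} [CommRing B] [Algebra A B]

/-- Projective dimension shifts along syzygies (`pd M < n + 1 + s`, `K = Ωˢ M` ⇒ `pd K < n + 1`).
[folklore] -/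
theorem hasProjectiveDimensionLT_of_isSyzygy :
    ∀ (s : ℕ) {M K : ModuleCat.{u} B}, IsSyzygy s M K → ∀ n : ℕ,
      HasProjectiveDimensionLT M (n + 1 + s) → HasProjectiveDimensionLT K (n + 1)
  | 0, _, _, ⟨e⟩, n, h => by
    haveI : HasProjectiveDimensionLT _ (n + 1) := h
    exact hasProjectiveDimensionLT_of_iso e.symm (n + 1)
  | s + 1, _, _, ⟨K', P, hK', _, hP, f, g, w, hS⟩, n, h => by
    have h' : HasProjectiveDimensionLT K' (n + 1 + 1) :=
      hasProjectiveDimensionLT_of_isSyzygy s hK' (n + 1)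
        (by rwa [show n + 1 + 1 + s = n + 1 + (s + 1) by omega])
    haveI : Projective P := hP
    have hP' : HasProjectiveDimensionLT (ShortComplex.mk f g w).X₂ (n + 1) :=
      hasProjectiveDimensionLT_of_ge P 1 (n + 1) (by omega)
    exact hS.hasProjectiveDimensionLT_X₁ (n + 1) hP' h'

/-- **Induction along a `B`-syzygy chain, read over `A`.** Let `I ⊆ A` kill `Ext^{≥1}_A(P|_A, N)`
(`N` finitely generated) for every finitely generated projective `B`-module `P`. If `K = Ωˢ_B M`
and `J ⊆ A` kills `Ext^{≥ m}_A(K|_A, N)`, then `J · Iˢ` kills `Ext^{≥ m+s}_A(M|_A, N)` — one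
factor of `I` per short exact sequence `0 → Ωʲ⁺¹ → Pⱼ → Ωʲ → 0`, restricted to `A` (restriction
of scalars is exact) and shifted in the cokernel direction. [this work] -/
theorem smul_ext_restrictScalars_eq_zero_of_isSyzygy (I : Ideal A)
    (hI : ∀ (P : ModuleCat.{u} B), Module.Finite B P → Projective P → ∀ a ∈ I, ∀ i : ℕ, 1 ≤ i →
      ∀ (N : ModuleCat.{u} A), Module.Finite A N →
        ∀ e : Ext.{u} ((restrictScalarsFunctor A B).obj P) N i, a • e = 0) :
    ∀ (s : ℕ) {M K : ModuleCat.{u} B}, IsSyzygy s M K → ∀ (J : Ideal A) (m : ℕ),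
      (∀ a ∈ J, ∀ i : ℕ, m ≤ i → ∀ (N : ModuleCat.{u} A), Module.Finite A N →
        ∀ e : Ext.{u} ((restrictScalarsFunctor A B).obj K) N i, a • e = 0) →
      ∀ a ∈ J * I ^ s, ∀ i : ℕ, m + s ≤ i → ∀ (N : ModuleCat.{u} A), Module.Finite A N →
        ∀ e : Ext.{u} ((restrictScalarsFunctor A B).obj M) N i, a • e = 0
  | 0, M, K, ⟨ε⟩, J, m, hJ => by
    intro a ha i hi N hN e
    rw [pow_zero, mul_one] at ha
    refine ext_smul_eq_zero_of_retract ((restrictScalarsFunctor A B).map ε.inv)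
      ((restrictScalarsFunctor A B).map ε.hom) ?_ a (hJ a ha i (by omega) N hN) e
    rw [← CategoryTheory.Functor.map_comp, ε.inv_hom_id, CategoryTheory.Functor.map_id]
  | s + 1, M, K, ⟨K', P, hK', hPfin, hPproj, f, g, w, hS⟩, J, m, hJ => by
    have hS' := hS.map_of_exact (restrictScalarsFunctor A B)
    -- `J * I` kills `Ext^{≥ m+1}` of `K'|_A` (cokernel of `K → P`)
    have hJK' : ∀ a ∈ J * I, ∀ i : ℕ, m + 1 ≤ i → ∀ (N : ModuleCat.{u} A), Module.Finite A N →
        ∀ e : Ext.{u} ((restrictScalarsFunctor A B).obj K') N i, a • e = 0 := by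
      intro a ha
      refine Submodule.mul_induction_on ha ?_ ?_
      · intro c hc d hd i hi N hN e
        obtain ⟨j, rfl⟩ : ∃ j, i = j + 1 := ⟨i - 1, by omega⟩
        exact mul_smul_ext_eq_zero_of_shortExact_X₃ hS' (hJ c hc j (by omega) N hN)
          (hI P hPfin hPproj d hd (j + 1) (by omega) N hN) e
      · intro x y hx hy i hi N hN e
        rw [add_smul, hx i hi N hN e, hy i hi N hN e, add_zero]
    have key := smul_ext_restrictScalars_eq_zero_of_isSyzygy I hI s hK' (J * I) (m + 1) hJK'
    intro a ha i hi N hN e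
    rw [pow_succ', ← mul_assoc] at ha
    exact key a ha i (by omega) N hN e

/-- **Split-cover floor for the cohomology annihilator.** Let `B` be a noetherian `A`-algebra
with an `A`-linear retraction `ρ : B → A`, `ρ 1 = 1`, and with `ca^{d+1}(B) = B` (every
finitely generated `B`-module has projective dimension `≤ d`). Then
`(ann_A Ext^{≥1}_A(B|_A, mod A))^{d+1} ⊆ ca^{d+1}(A)`: for finitely generated `M`, `M` is a
retract of `(B ⊗_A M)|_A`, whose `d`-th `B`-syzygy is a finitely generated projective, hence in
`add(B|_A)`, and the syzygy chain costs one factor per step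
(`smul_ext_restrictScalars_eq_zero_of_isSyzygy`). [this work] -/
theorem pow_extAnnihilatorFrom_restrictScalars_le_cohomologyAnnihilatorOfDegree
    [IsNoetherianRing B] (ρ : B →ₗ[A] A) (hρ : ρ 1 = 1) {d : ℕ}
    (hB : cohomologyAnnihilatorOfDegree B (d + 1) = ⊤) :
    extAnnihilatorFrom ((restrictScalarsFunctor A B).obj (ModuleCat.of B B)) 1 ^ (d + 1) ≤
      cohomologyAnnihilatorOfDegree A (d + 1) := by
  set G : ModuleCat.{u} A := (restrictScalarsFunctor A B).obj (ModuleCat.of B B) with hG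
  set I : Ideal A := extAnnihilatorFrom G 1 with hIdef
  have hI : ∀ (P : ModuleCat.{u} B), Module.Finite B P → Projective P → ∀ a ∈ I, ∀ i : ℕ, 1 ≤ i →
      ∀ (N : ModuleCat.{u} A), Module.Finite A N →
        ∀ e : Ext.{u} ((restrictScalarsFunctor A B).obj P) N i, a • e = 0 := by
    intro P hP hproj a ha i hi N hN e
    have hret : IsRetractOfPower G ((restrictScalarsFunctor A B).obj P) :=
      (IsRetractOfPower.of_projective (isRetractOfPower_self _) hP hproj).restrictScalars
    rw [hIdef, mem_extAnnihilatorFrom_iff] at ha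
    exact ext_smul_eq_zero_of_isRetractOfPower hret a (ha i hi N hN) e
  intro a ha
  rw [mem_cohomologyAnnihilatorOfDegree_iff]
  intro i hi M N hM hN e
  haveI := hM
  obtain ⟨ι, π, hιπ⟩ := exists_retract_restrictScalars_baseChange A B ρ hρ M
  refine ext_smul_eq_zero_of_retract ι π hιπ a (fun e' => ?_) e
  haveI : Module.Finite B (ModuleCat.of B (TensorProduct A B M)) := Module.Finite.base_change A B M
  obtain ⟨K, hKfin, hK⟩ := exists_isSyzygy (ModuleCat.of B (TensorProduct A B M)) d
  have hMpd : HasProjectiveDimensionLT (ModuleCat.of B (TensorProduct A B M)) (0 + 1 + d) := by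
    rw [Nat.zero_add, Nat.add_comm]
    exact hasProjectiveDimensionLT_of_cohomologyAnnihilatorOfDegree_eq_top hB _
  have hKpd : HasProjectiveDimensionLT K (0 + 1) := hasProjectiveDimensionLT_of_isSyzygy d hK 0 hMpd
  have hKproj : Projective K :=
    projective_iff_hasProjectiveDimensionLT_one.mpr (by simpa using hKpd)
  have hJ : ∀ b ∈ I, ∀ j : ℕ, 1 ≤ j → ∀ (N : ModuleCat.{u} A), Module.Finite A N →
      ∀ x : Ext.{u} ((restrictScalarsFunctor A B).obj K) N j, b • x = 0 :=
    fun b hb j hj N hN x => hI K hKfin hKproj b hb j hj N hN x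
  have key := smul_ext_restrictScalars_eq_zero_of_isSyzygy I hI d hK I 1 hJ
  have ha' : a ∈ I * I ^ d := by rwa [← pow_succ']
  exact key a ha' i (by omega) N hN e'

/-- The same floor inside the full cohomology annihilator `ca(A)`. [this work] -/
theorem pow_extAnnihilatorFrom_restrictScalars_le_cohomologyAnnihilator
    [IsNoetherianRing B] (ρ : B →ₗ[A] A) (hρ : ρ 1 = 1) {d : ℕ}
    (hB : cohomologyAnnihilatorOfDegree B (d + 1) = ⊤) :
    extAnnihilatorFrom ((restrictScalarsFunctor A B).obj (ModuleCat.of B B)) 1 ^ (d + 1) ≤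
      cohomologyAnnihilator A :=
  (pow_extAnnihilatorFrom_restrictScalars_le_cohomologyAnnihilatorOfDegree ρ hρ hB).trans
    (cohomologyAnnihilatorOfDegree_le (d + 1))

/-- **Regular covers.** If `B` is a REGULAR ring of Krull dimension `≤ d` (e.g. a polynomial
ring in `d` variables over a field) splitting off `A`, then
`(ann_A Ext^{≥1}_A(B|_A, mod A))^{d+1} ⊆ ca^{d+1}(A)` — the case `A = k[σ^∨∩M] ⊂ B = k[y₁,…,y_d]`
of an abelian quotient singularity. [this work] -/
theorem pow_extAnnihilatorFrom_restrictScalars_le_of_isRegularRing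
    [IsRegularRing B] (ρ : B →ₗ[A] A) (hρ : ρ 1 = 1) {d : ℕ}
    (hd : ringKrullDim B ≤ d) :
    extAnnihilatorFrom ((restrictScalarsFunctor A B).obj (ModuleCat.of B B)) 1 ^ (d + 1) ≤
      cohomologyAnnihilatorOfDegree A (d + 1) :=
  pow_extAnnihilatorFrom_restrictScalars_le_cohomologyAnnihilatorOfDegree ρ hρ
    (cohomologyAnnihilatorOfDegree_eq_top_of_isRegularRing B hd)

/-! ## Summands: the intersection of the stable annihilators of the isotypic pieces

For an abelian quotient `A = k[σ^∨∩M] ⊂ B = k[y₁,…,y_d]` the `A`-module `B|_A` is the direct sum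
of the finitely many isotypic (conic) modules `S_χ`, and `TR = ⋂_χ tr(S_χ)` consists of elements
`a` whose homothety on EACH `S_χ` factors through a free module. The lemmas below turn that into
membership in `ann_A Ext^{≥1}_A(B|_A, mod A)`, so that the split-cover floor reads
`TR^{d+1} ⊆ ca^{d+1}(A)` (KERNEL-g13 §3.1). -/

/-- `Ext` out of a finite product is controlled factorwise: if `a` kills `Extⁿ(S j, N)` for every
`j` then `a` kills `Extⁿ(Π j, S j, N)` (`𝟙 = Σⱼ πⱼ ≫ ιⱼ` and bilinearity of composition).
[folklore] -/
theorem ext_smul_eq_zero_of_piFamily {ι : Type} [Fintype ι] [DecidableEq ι]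
    (S : ι → ModuleCat.{u} A) {N : ModuleCat.{u} A} {n : ℕ} (a : A)
    (hS : ∀ (j : ι) (e : Ext.{u} (S j) N n), a • e = 0)
    (e : Ext.{u} (ModuleCat.of A (Π j, S j)) N n) : a • e = 0 := by
  let π : ∀ j : ι, (ModuleCat.of A (Π j, S j) ⟶ S j) := fun j => ModuleCat.ofHom (LinearMap.proj j)
  let ι' : ∀ j : ι, (S j ⟶ ModuleCat.of A (Π j, S j)) :=
    fun j => ModuleCat.ofHom (LinearMap.single A (fun j => (S j : Type u)) j)
  have hid : ∑ j, π j ≫ ι' j = 𝟙 (ModuleCat.of A (Π j, S j)) := by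
    apply ModuleCat.hom_ext
    refine LinearMap.ext fun v => ?_
    simp only [ModuleCat.hom_sum, ModuleCat.hom_comp, LinearMap.coe_sum, Finset.sum_apply,
      LinearMap.coe_comp, Function.comp_apply, ModuleCat.hom_id, LinearMap.id_coe, id_eq]
    conv_rhs => rw [← Finset.univ_sum_single v]
    simp [π, ι']
  have he : e = ∑ j, (Ext.mk₀ (π j)).comp ((Ext.mk₀ (ι' j)).comp e (zero_add n)) (zero_add n) := by
    simp only [Ext.mk₀_comp_mk₀_assoc]
    rw [← Ext.sum_comp, ← Ext.mk₀_sum, hid, Ext.mk₀_id_comp]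
  rw [he, Finset.smul_sum]
  refine Finset.sum_eq_zero fun j _ => ?_
  rw [← Ext.comp_smul, hS j, Ext.comp_zero]

/-- **Stable annihilators of the summands land in `ann Ext^{≥1}` of the sum.** If for every `j`
the homothety `a • 𝟙 (S j)` factors through a projective module, then
`a ∈ ann_A Ext^{≥1}_A(Π j, S j, mod A)` (`extAnnihilatorFrom _ 1`). [this work] -/
theorem mem_extAnnihilatorFrom_pi_of_forall_stablyZero {ι : Type} [Fintype ι] [DecidableEq ι]
    (S : ι → ModuleCat.{u} A) (a : A)
    (h : ∀ j : ι, ∃ (P : ModuleCat.{u} A) (_ : Projective P) (i : S j ⟶ P) (p : P ⟶ S j),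
      i ≫ p = a • 𝟙 (S j)) :
    a ∈ extAnnihilatorFrom (ModuleCat.of A (Π j, S j)) 1 := by
  rw [mem_extAnnihilatorFrom_iff]
  intro i hi N _ e
  refine ext_smul_eq_zero_of_piFamily S a (fun j e' => ?_) e
  obtain ⟨P, hP, ι', p, hιp⟩ := h j
  exact smul_ext_eq_zero_of_comp_eq_smul_id ι' p hιp hi e'

/-- **`TR^{d+1} ⊆ ca^{d+1}` in abstract form.** Let `B` be a noetherian `A`-algebra splitting off
`A` (`ρ`, `ρ 1 = 1`) with `ca^{d+1}(B) = B`, and suppose `B|_A ≅ Π j, S j` for finitely many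
`A`-modules `S j` (the isotypic decomposition). If every element of an ideal `J ⊆ A` acts STABLY
ZERO on each `S j` (its homothety factors through a projective `A`-module — for a rank-one
reflexive `S j` over a domain this says `J ⊆ tr(S j)`), then `J^{d+1} ⊆ ca^{d+1}(A)`. [this work] -/
theorem pow_le_cohomologyAnnihilatorOfDegree_of_stablyZero_on_summands [IsNoetherianRing B]
    (ρ : B →ₗ[A] A) (hρ : ρ 1 = 1) {d : ℕ} (hB : cohomologyAnnihilatorOfDegree B (d + 1) = ⊤)
    {ι : Type} [Fintype ι] [DecidableEq ι] (S : ι → ModuleCat.{u} A)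
    (eiso : (restrictScalarsFunctor A B).obj (ModuleCat.of B B) ≅ ModuleCat.of A (Π j, S j))
    (J : Ideal A)
    (hJ : ∀ a ∈ J, ∀ j : ι, ∃ (P : ModuleCat.{u} A) (_ : Projective P) (i : S j ⟶ P) (p : P ⟶ S j),
      i ≫ p = a • 𝟙 (S j)) :
    J ^ (d + 1) ≤ cohomologyAnnihilatorOfDegree A (d + 1) := by
  have hJle : J ≤ extAnnihilatorFrom ((restrictScalarsFunctor A B).obj (ModuleCat.of B B)) 1 := by
    intro a ha
    have hpi := mem_extAnnihilatorFrom_pi_of_forall_stablyZero S a (hJ a ha)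
    rw [mem_extAnnihilatorFrom_iff] at hpi ⊢
    intro i hi N hN e
    exact ext_smul_eq_zero_of_retract eiso.hom eiso.inv eiso.hom_inv_id a (hpi i hi N hN) e
  exact (Ideal.pow_right_mono hJle (d + 1)).trans
    (pow_extAnnihilatorFrom_restrictScalars_le_cohomologyAnnihilatorOfDegree ρ hρ hB)

end Summit.ResolutionOfSingularities.ResolutionOfSingularities.Theorems.NoZeno.SplitCoverFloor

end
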